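import Summits.ResolutionOfSingularities.ResolutionOfSingularities.Theorems.HilbertSamuelEliminationSigmaMaxModificationsCorridor3WLadderMovingTwoThirdDoor
import Summits.ResolutionOfSingularities.ResolutionOfSingularities.Theorems.HilbertSamuelEliminationSigmaMaxModificationsCorridor3WLadderResidue
import Summits.ResolutionOfSingularities.ResolutionOfSingularities.Theorems.HilbertSamuelEliminationSigmaMaxModificationsCorridor3RegularValue
import HarnessLib

/-!
# [OURS · L1 W4.2] THE RESIDUE OF THE CHARACTERISTIC-2 ROW `stub_Wlow3M_two`, NAMED, and the crux conjunct's residue WITH THE `p = 2`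
# ROW OPENED UP (crux chain w42, line `w_ladder` v6; CHAIN v3.9a (M) / (H-β); `--supports stmt-ResolutionOfSingularities-19249`, helper)

Stub worker res-L1-w42-stub-3 (gen 3). Lead-1's `…Corridor3WLadderResidue` (`sigmaMaxModificationsCorridor3_of_residue`) takes the `p = 2`
row whole, as the OURS hypothesis `∀ p, p.Prime → Wlow3TwoM p`. This file replaces that hypothesis by the row's RESIDUE OF RECORD:

* **`wlow3TwoM_of_residue`** — THE (H-β) THEOREM WITH NAMED BINDERS: `∀ p, p.Prime → Wlow3TwoM p` from the residue R_β
  {`KeyTheorem640_isolated` (char-free Thm. 6.40 at isolated unit starts), `Corollary637_geomDir` (Cor. 6.37 under (F1♯))}, the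
  (F1♯)-shadow `Theorem314_geomDir` (⟸ 2.14♯, T7), and the three OURS CONSTRUCTIONS `IsoE1BridgeFreeM 2` (the `e = 1` bridge at an
  isolated start, char-free twin of lead-1's `IsoE1BridgeM`), `UnitTowerExtractionFreeM 2` (units bridge without `CharHypothesis`),
  `WlowStrataM 2` (G1′) — every other prime being vacuous;
* `isoLowDirDimTerminatesFreeM_of_bridge` — the third-door socket from `Theorem314_geomDir` + `Corollary637_geomDir` + `IsoE1BridgeFreeM p`
  (the regular value `ν = Φ^{(3)}` is dispatched by stub-1's fact-free `IsMaximalOrigin.noMovingNearChainFrom_of_eq_iterPSum`);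
* **`sigmaMaxModificationsCorridor3_of_residue_two`** — lead-1's ONE-STATEMENT CENSUS of the conjunct `SigmaMaxModificationsCorridor3`
  with `hTwo` REPLACED by those six inputs: the conjunct from SIX PRINTED facts, the THREE (F1)-regime OURS constructions, the TWO OURS
  CLAIMS + ONE SHADOW of R_β, the THREE characteristic-2 OURS constructions, and the TWO core W-top rows. CONDITIONAL — credits nothing.

OURS (cell res-hironaka, slot W4.2); NOT statements of the manuscript [Hironaka2017] nor of [CossartJannsenSaito2020];
AI-drafted, weaker than expert review. References: CJS LNM 2270 Thm. 3.10 (4), Thm. 3.14, Def. 6.34, Cor. 6.37, Def. 6.38/6.39, Thm. 6.40,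
Thm. 6.28, Thm. 1.2 [CossartJannsenSaito2020]; H. Mizutani, Nagoya Math. J. 52 (1973) Thm. 2.8 [Mizutani1973HironakaGroupSchemes]; CHAIN v3.9a.
-/

noncomputable section

-- namespace `…Corridor3.Moving` re-enters `…Corridor3` (module convention of the Moving files)
set_option linter.dupNamespace false

open CategoryTheory AlgebraicGeometry TopologicalSpace IsLocalRing
open Literature.AlgebraicGeometry.Resolution Literature.RingTheory.HilbertSamuel
open Summit.ResolutionOfSingularities.ResolutionOfSingularities.Theorems.CampaignW42
open Literature.AlgebraicGeometry.CossartJannsenSaito2020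
open Summit.ResolutionOfSingularities.ResolutionOfSingularities.Theses.HilbertSamuelElimination
open Summit.ResolutionOfSingularities.ResolutionOfSingularities.Theorems.SigmaMaxModificationsCorridor3

namespace Summit.ResolutionOfSingularities.ResolutionOfSingularities.Theorems.SigmaMaxModificationsCorridor3.Moving

/-- **The third-door socket of the characteristic-2 row from its NAMED residue**: `Theorem314_geomDir` (e = 0), `Corollary637_geomDir` +
`IsoE1BridgeFreeM p` (e = 1); the regular value is dispatched fact-free (stub-1). [cite: CossartJannsenSaito2020, Cor. 6.37, Thm. 3.14, Lemma 2.31] -/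
theorem isoLowDirDimTerminatesFreeM_of_bridge {p : ℕ} (hF : Theorem314_geomDir.{0}) (hC : Corollary637_geomDir.{0})
    (hB : IsoE1BridgeFreeM p) : IsoLowDirDimTerminatesFreeM p :=
  isoLowDirDimTerminatesFreeM_of_doors hF hC fun R hRf hRa ν X _ x hX s hreach hiso he hē c h0 hstep hG hmov => by
    by_cases hν : ν = iterPSum 3 Phi
    · exact ((hX.noMovingNearChainFrom_of_eq_iterPSum hRa hν fun t => t.geomDirDim ≤ 2)
        ⟨c, hreach.trans h0, hstep, hG, hmov⟩).elim
    · exact hB R hRf hRa ν X x hX hν s hreach hiso he hē c h0 hstep hG hmov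

/-- **THE CHARACTERISTIC-2 ROW FROM ITS RESIDUE OF RECORD (the (H-β) theorem with named binders).** `∀ p, p.Prime → Wlow3TwoM p` from:
the OURS CLAIMS `KeyTheorem640_isolated`, `Corollary637_geomDir` (R_β), the (F1♯)-shadow `Theorem314_geomDir`, and the OURS CONSTRUCTIONS
`IsoE1BridgeFreeM 2`, `UnitTowerExtractionFreeM 2`, `WlowStrataM 2`. [folklore] -/
theorem wlow3TwoM_of_residue (hK : KeyTheorem640_isolated.{0}) (hC : Corollary637_geomDir.{0}) (hF : Theorem314_geomDir.{0})
    (hB : IsoE1BridgeFreeM 2) (hU : UnitTowerExtractionFreeM 2) (hS : WlowStrataM 2) : ∀ p : ℕ, p.Prime → Wlow3TwoM.{0} p :=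
  stub_Wlow3M_two_of_two
    (wlow3TwoM_of_wlowM (wlowM_assembled_freeSocket hK (isoLowDirDimTerminatesFreeM_of_bridge hF hC hB) hU hS))

/-- **THE RESIDUE OF `SigmaMaxModificationsCorridor3` WITH THE `p = 2` ROW OPENED UP** — lead-1's `sigmaMaxModificationsCorridor3_of_residue`
with its hypothesis `∀ p, p.Prime → Wlow3TwoM p` replaced by the characteristic-2 residue: the conjunct from the six PRINTED facts
(CJS Thm. 6.28 ν-form, Thm. 1.2 sequence form, Thm. 3.10 (4), Thm. 6.40 isolated (F1), Cor. 6.37 (F1), Thm. 3.14), the three (F1)-regime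
OURS constructions (`IsoE1BridgeM`, `UnitTowerExtractionQM`, `Wlow3CharStrataM`), the characteristic-2 residue (OURS claims
`KeyTheorem640_isolated`, `Corollary637_geomDir`; shadow `Theorem314_geomDir`; OURS constructions `IsoE1BridgeFreeM 2`,
`UnitTowerExtractionFreeM 2`, `WlowStrataM 2`), and THE CORE (`Wtop3PointedM`, `Wtop3NonpointedM`). CONDITIONAL — credits nothing.
[OURS · L1 W4.2]; NOT a statement of the manuscript. [cite: CossartJannsenSaito2020, Def. 6.15, Rem. 6.29, Thm. 1.2, Thm. 3.10, Thm. 3.14, Thm. 6.28, Cor. 6.37, Thm. 6.40] -/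
theorem sigmaMaxModificationsCorridor3_of_residue_two
    (hNu : CossartJannsenSaito2020_nuElimination.{0}) (hSeq : CossartJannsenSaito2020SequencePermissible.{0})
    (h310 : CossartJannsenSaito2020_thm_3_10_4.{0}) (hK : KeyTheorem640_char_isolated.{0}) (hC : Corollary637_char.{0})
    (h314 : CossartJannsenSaito2020_thm_3_14.{0})
    (hB : ∀ p : ℕ, p.Prime → IsoE1BridgeM p) (hU : ∀ p : ℕ, p.Prime → UnitTowerExtractionQM p)
    (hS : ∀ p : ℕ, p.Prime → Wlow3CharStrataM p)
    (hK₂ : KeyTheorem640_isolated.{0}) (hC₂ : Corollary637_geomDir.{0}) (hF₂ : Theorem314_geomDir.{0})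
    (hB₂ : IsoE1BridgeFreeM 2) (hU₂ : UnitTowerExtractionFreeM 2) (hS₂ : WlowStrataM 2)
    (hTopP : ∀ p : ℕ, p.Prime → Wtop3PointedM.{0} p) (hTopN : ∀ p : ℕ, p.Prime → Wtop3NonpointedM.{0} p) :
    SigmaMaxModificationsCorridor3 :=
  Residue.sigmaMaxModificationsCorridor3_of_residue hNu hSeq h310 hK hC h314 hB hU hS
    (wlow3TwoM_of_residue hK₂ hC₂ hF₂ hB₂ hU₂ hS₂) hTopP hTopN

end Summit.ResolutionOfSingularities.ResolutionOfSingularities.Theorems.SigmaMaxModificationsCorridor3.Moving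

end
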